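import Summits.HubbardSuperconductivity.HubbardSuperconductivity.Theses.LiebTwin
import Summits.HubbardSuperconductivity.HubbardSuperconductivity.Theorems.LiebTwinDWavePolarisedDiscordancePairTransfer
import Summits.HubbardSuperconductivity.HubbardSuperconductivity.Theorems.LiebTwinDWavePolarisedDiscordanceStubMassFeedsOfCrux
import Summits.HubbardSuperconductivity.HubbardSuperconductivity.Theorems.LiebTwinBondLocalityGlue
import Summits.HubbardSuperconductivity.HubbardSuperconductivity.Theorems.LiebTwinDWavePolarisedDiscordanceStubChannelCompleteness

/-!
# Line `Sketch` (card `Ideas/channel-exhaustion-sum-rule.md`) — crux `DWavePolarisedDiscordance` (K3′)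
# of route `LiebTwin`, item `stmt-HubbardSuperconductivity-15314` — lead c2 skeleton

Crux (by name `…Theses.LiebTwin.DWavePolarisedDiscordance`): for every `(U, δ) ∈ (0,4] × [1/10,3/10]`
there is `κ > 0` such that for every `ε > 0`, eventually in even `L`, EVERY normalised `(N_L, 0)`-sector
ground state `φ` of `hubbardTorus 2 L 1 U` has `κ·m − εL⁴ ≤ D − D′`, where (with `n = ⌊(1−δ)L²/2⌋`,
`W = liebW n φ`, `A = |W| = CFC.abs W`, twin `φ̃ = liebVec n A`, `F_g(χ) = Re⟨χ, Δ_gᴴΔ_g χ⟩`,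
`Δ_g = pairField g L`): `m := F_s(φ̃) − F_s(φ)` (discordance mass), `D := F_d(φ)`, `D′ := F_d(φ̃)`,
`X := F_xs(φ)`, `X′ := F_xs(φ̃)`.

## The line: exhaustion of channels (an exact conservation law + two budgets + the sibling crux)

Lieb transfer (landed `LiebTwinDiscordance.expect_pairField_eq_of_even`, p154877): for even `g`,
`F_g(ψ) = Σ_{x,e,x',e'} 2 g(e)g(e') Tr(W(ψ)ᴴ B_{x x'} W(ψ) B_{x+e, x'+e'}ᵀ)`, `B_{uv} = configHop n u v`.
Relative-coordinate CHANNEL KERNEL of a pair `(M, N)` of Lieb matrices: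
`chan_{M,N}(r, r') := Σ_{x,x'} Tr(M B_{x x'} N B_{x+r, x'+r'}ᵀ)` (`r, r' ∈ (ℤ/L)²`), so that
`⟨Δ_rᴴ Δ_{r'}⟩_ψ = chan_{Wᴴ,W}(r,r')` for the bare channel fields `Δ_r = Σ_x c_{x↑}c_{x+r,↓}` and
`F_g = 2 Σ_{e,e'} g(e)g(e') chan(e,e')`. GAIN KERNEL `G(r,r') := chan_{Wᴴ,W}(r,r') − chan_{Aᴴ,A}(r,r')`
(state minus twin). Then `m = −2·Re G(0,0)`, `D − D′ = 8⟨ĝ_d, G ĝ_d⟩`, `X − X′ = 8⟨ĝ_xs, G ĝ_xs⟩`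
(`ĝ = g/2` unit vectors of `ℓ²((ℤ/L)²)` supported on the four unit steps).

* `stub_channelCompleteness` (KINEMATIC, provable now, size M): for ALL matrices `M, N`,
  `Σ_r chan_{M,N}(r,r) = Σ_a Tr(M 𝒯_a N 𝒯_aᵀ)`, `𝒯_a := Σ_x B_{x, x+a}` (rigid displacement by `a`):
  substituting `x' = x + a`, the inner sums over `x` and over `r` each collapse to `𝒯_a`.
  Consequence (the CONSERVATION LAW): `Tr G = Σ_r G(r,r) = −4·Leak`,
  `Leak := ¼ Σ_a Re[Tr(Aᴴ𝒯_aA𝒯_aᵀ) − Tr(Wᴴ𝒯_aW𝒯_aᵀ)]` ( `= (L²/4)Σ_k[⟨n_{k↑}n_{−k↓}⟩_φ̃ − ⟨n_{k↑}n_{−k↓}⟩_φ]`,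
  the ZERO-TRANSFER discordance; `≥ 0` when `W` is Hermitian: `Σ_a ‖(W⁺)^½𝒯_a(W⁻)^½‖²`).
  Reading `Tr G` in the orthonormal basis `{δ₀, ĝ_d, ĝ_xs, t̂_x, t̂_y} ⊕ (|r| ≥ √2)` gives the card's
  MASTER IDENTITY `D − D′ = 4m − 32·Leak − (X − X′) − 8·Exotic`,
  `Exotic := Re Tr G − Re G(0,0) − (D−D′)/8 − (X−X′)/8` (gain in the NN-odd and all farther channels).
* `stub_leakBound` (PHYSICS BET 1, engine-less ground-state conjecture; the HARDEST, held by the lead):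
  `∃ η < 2`: `32·Leak ≤ η·m + εL⁴` for every normalised sector GS, eventually — "the Lieb involution of a
  ground state is momentum-diagonal in the |W|-weighted sense" (exactly `Leak = 0` for every gap-sign
  involution, card P2 anchor; `O(U³)` at fixed `L`).
* `stub_exoticBudget` (PHYSICS BET 2, engine-less): `∃ θ < 2`: `8·Exotic ≤ θ·m + εL⁴` — the sign defect
  does not feed NN-triplet / `d_xy` / range `≥ √2` channels beyond what the twin's own tail supplies.
* `stub_noOnsiteODLRO` (= the SIBLING CRUX `Theses.LiebTwin.NoOnsiteODLRO`, shared item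
  stmt-HubbardSuperconductivity-0933, hypothesis `hNo` of `LiebTwin.closes`; expected `stub-blocked`): it
  closes the extended-`s` sink through the LANDED slaving theorem
  `LiebTwinBondLocality.extendedS_le_of_noOnsiteODLRO` (p153625): `X ≤ εL⁴` uniformly on the box.

ASSEMBLY `DWavePolarisedDiscordance_of` (kernel-checked, no `sorry`): `κ := 4 − η − θ > 0`;
`D − D′ = 8·TrG + 4m − (X−X′) − 8·Exotic` (definition of Exotic) `= −32·Leak + 4m − (X−X′) − 8·Exotic`
(completeness, twice) `≥ (4 − η − θ)·m − 3·(ε/3)L⁴` (the two budgets, `X ≤ (ε/3)L⁴`, `X′ ≥ 0`).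
Everything is stated for EVERY sector vector (complex members of degenerate multiplets included): the
identities need no Hermiticity of `W`, so the rev-1 typing hole (census N4) does not touch this line.

Disproof used (Cruxes/DWavePolarisedDiscordance/Disproof.lean, cdisprove cycle 1, read 2026-08-17T13:20Z):
`Negative.dWavePolarisedDiscordance_false_without_minimality` (p156766) — the normalised staggered η-tower is
a sector EIGENVECTOR with maximal mass and `D = D′`, `X = X′` (bond orders twin-invariant), hence
`32·Leak + 8·Exotic = 4m` there: BOTH budgets are false for eigenvectors and must use `minEnergyOn` — they keep
the crux's `IsGroundStateInSector` clause verbatim. No `-- Targets` entry exists for these stubs yet.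
Negatives index (stmt-1180, stmt-1314): untouched.
-/

-- the mandated namespace repeats `HubbardSuperconductivity` (single-problem summit, D-0017)
set_option linter.dupNamespace false

namespace Summit.HubbardSuperconductivity.HubbardSuperconductivity.Cruxes.DWavePolarisedDiscordance.Sketch

open Summit.HubbardSuperconductivity.HubbardSuperconductivity.Theses.LiebTwin
open Literature.MathematicalPhysics.QuantumLattice Literature.Probability.LatticeModels
open scoped Matrix MatrixOrder Matrix.Norms.L2Operator ComplexOrder

/-! ## Name-keyed aliases of the stub statements (the hypotheses of `DWavePolarisedDiscordance_of`) -/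
namespace __Registered

/-- Alias: the statement of `stub_channelCompleteness` (CLOSED, p163800), kept for the record. -/
abbrev stub_channelCompleteness : Prop :=
  ∀ (L : ℕ) [NeZero L] (n : ℕ)
    (M N : Matrix (Config (FermionTorus 2 L) n) (Config (FermionTorus 2 L) n) ℂ),
    ∑ r : TorusSite 2 L, ∑ x : TorusSite 2 L, ∑ x' : TorusSite 2 L,
        (M * configHop n (FermionTorus.ofTorusSite x) (FermionTorus.ofTorusSite x') * N *
          (configHop n (FermionTorus.ofTorusSite (x + r)) (FermionTorus.ofTorusSite (x' + r)))ᵀ).trace =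
      ∑ a : TorusSite 2 L,
        (M * (∑ x : TorusSite 2 L, configHop n (FermionTorus.ofTorusSite x) (FermionTorus.ofTorusSite (x + a))) *
          N * (∑ x : TorusSite 2 L,
            configHop n (FermionTorus.ofTorusSite x) (FermionTorus.ofTorusSite (x + a)))ᵀ).trace

/-- Alias: the statement of `stub_leakBound`, keyed by the stub name. -/
abbrev stub_leakBound : Prop :=
  ∀ U ∈ Set.Ioc (0 : ℝ) 4, ∀ δ ∈ Set.Icc (1 / 10 : ℝ) (3 / 10), ∃ η : ℝ, η < 2 ∧ ∀ ε : ℝ, 0 < ε →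
    ∃ L₀ : ℕ, ∀ (L : ℕ) [NeZero L], L₀ ≤ L → Even L → ∀ n : ℕ, n = ⌊(1 - δ) * (L : ℝ) ^ 2 / 2⌋₊ →
      ∀ φ : Fock (Orb (FermionTorus 2 L)), star φ ⬝ᵥ φ = 1 →
        IsGroundStateInSector (hubbardTorus 2 L 1 U) (2 * n) 0 φ →
          ∀ (W A : Matrix (Config (FermionTorus 2 L) n) (Config (FermionTorus 2 L) n) ℂ)
            (T : TorusSite 2 L → Matrix (Config (FermionTorus 2 L) n) (Config (FermionTorus 2 L) n) ℂ),
            W = liebW n φ → A = CFC.abs W →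
              (T = fun a => ∑ x : TorusSite 2 L,
                configHop n (FermionTorus.ofTorusSite x) (FermionTorus.ofTorusSite (x + a))) →
                8 * (∑ a : TorusSite 2 L,
                    ((Aᴴ * T a * A * (T a)ᵀ).trace - (Wᴴ * T a * W * (T a)ᵀ).trace)).re ≤
                  η * ((expect ((pairField sWave L)ᴴ * pairField sWave L) (liebVec n A)).re -
                        (expect ((pairField sWave L)ᴴ * pairField sWave L) φ).re) +
                    ε * (L : ℝ) ^ 4

/-- Alias: the statement of `stub_exoticBudget`, keyed by the stub name. -/
abbrev stub_exoticBudget : Prop :=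
  ∀ U ∈ Set.Ioc (0 : ℝ) 4, ∀ δ ∈ Set.Icc (1 / 10 : ℝ) (3 / 10), ∃ θ : ℝ, θ < 2 ∧ ∀ ε : ℝ, 0 < ε →
    ∃ L₀ : ℕ, ∀ (L : ℕ) [NeZero L], L₀ ≤ L → Even L → ∀ n : ℕ, n = ⌊(1 - δ) * (L : ℝ) ^ 2 / 2⌋₊ →
      ∀ φ : Fock (Orb (FermionTorus 2 L)), star φ ⬝ᵥ φ = 1 →
        IsGroundStateInSector (hubbardTorus 2 L 1 U) (2 * n) 0 φ →
          ∀ (W A : Matrix (Config (FermionTorus 2 L) n) (Config (FermionTorus 2 L) n) ℂ)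
            (φt : Fock (Orb (FermionTorus 2 L)))
            (B : TorusSite 2 L → TorusSite 2 L →
              Matrix (Config (FermionTorus 2 L) n) (Config (FermionTorus 2 L) n) ℂ),
            W = liebW n φ → A = CFC.abs W → φt = liebVec n A →
              (B = fun x x' => configHop n (FermionTorus.ofTorusSite x) (FermionTorus.ofTorusSite x')) →
                ∀ trG m dgain xgain : ℝ,
                  trG = (∑ r : TorusSite 2 L, ∑ x : TorusSite 2 L, ∑ x' : TorusSite 2 L,
                    ((Wᴴ * B x x' * W * (B (x + r) (x' + r))ᵀ).trace -
                      (Aᴴ * B x x' * A * (B (x + r) (x' + r))ᵀ).trace)).re →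
                  m = (expect ((pairField sWave L)ᴴ * pairField sWave L) φt).re -
                    (expect ((pairField sWave L)ᴴ * pairField sWave L) φ).re →
                  dgain = (expect ((pairField dWaveFormFactor L)ᴴ * pairField dWaveFormFactor L) φ).re -
                    (expect ((pairField dWaveFormFactor L)ᴴ * pairField dWaveFormFactor L) φt).re →
                  xgain = (expect ((pairField extendedSWave L)ᴴ * pairField extendedSWave L) φ).re -
                    (expect ((pairField extendedSWave L)ᴴ * pairField extendedSWave L) φt).re →
                    8 * trG + 4 * m - dgain - xgain ≤ θ * m + ε * (L : ℝ) ^ 4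

/-- Alias: the statement of `stub_noOnsiteODLRO`, keyed by the stub name (the sibling crux, verbatim). -/
abbrev stub_noOnsiteODLRO : Prop :=
  Summit.HubbardSuperconductivity.HubbardSuperconductivity.Theses.LiebTwin.NoOnsiteODLRO

end __Registered

/-! ## Stubs (the ONLY declarations of this file containing `sorry` are stubs 2–4; stub 1 CLOSED by p163800)

Reshape note (cycle 1): the first registration used `let`-bound abbreviations inside the two budget statements; the
skeleton extractor truncates a signature at the first `:=`, so the registered texts were cut at `let n : ℕ`. The
budgets are therefore restated with universally quantified abbreviations pinned by equations
(`∀ n, n = ⌊(1−δ)L²/2⌋₊ → … ∀ W A T, W = liebW n φ → A = CFC.abs W → T = (fun a ↦ Σ_x B_{x,x+a}) → …`) —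
logically the same statements, no `:=` inside. -/

/-- STUB 1 — CHANNEL COMPLETENESS (kinematic; the relative-channel conservation law behind `Tr G = −4·Leak`):
for all Lieb-space matrices `M, N` on the torus of side `L`,
`Σ_r Σ_{x,x'} Tr(M B_{x x'} N B_{x+r, x'+r}ᵀ) = Σ_a Tr(M 𝒯_a N 𝒯_aᵀ)`, `𝒯_a = Σ_x B_{x, x+a}`, `B_{uv} = configHop n u v`.
LANDED (wave 1, stub-worker, p163800): `Theorems.LiebTwinChannelExhaustion.stub_channelCompleteness`. [folklore] -/
theorem stub_channelCompleteness :
    ∀ (L : ℕ) [NeZero L] (n : ℕ)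
      (M N : Matrix (Config (FermionTorus 2 L) n) (Config (FermionTorus 2 L) n) ℂ),
      ∑ r : TorusSite 2 L, ∑ x : TorusSite 2 L, ∑ x' : TorusSite 2 L,
          (M * configHop n (FermionTorus.ofTorusSite x) (FermionTorus.ofTorusSite x') * N *
            (configHop n (FermionTorus.ofTorusSite (x + r)) (FermionTorus.ofTorusSite (x' + r)))ᵀ).trace =
        ∑ a : TorusSite 2 L,
          (M * (∑ x : TorusSite 2 L, configHop n (FermionTorus.ofTorusSite x) (FermionTorus.ofTorusSite (x + a))) *
            N * (∑ x : TorusSite 2 L,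
              configHop n (FermionTorus.ofTorusSite x) (FermionTorus.ofTorusSite (x + a)))ᵀ).trace :=
  Summit.HubbardSuperconductivity.HubbardSuperconductivity.Theorems.LiebTwinChannelExhaustion.stub_channelCompleteness

/-- STUB 2 — LEAK BOUND (physics bet 1 of card channel-exhaustion-sum-rule; engine-less ground-state conjecture; held by
the lead): for every `(U, δ)` in the box there is `η < 2` such that for every `ε > 0`, eventually in even `L`, every
normalised sector ground state `φ` has `32·Leak(φ) ≤ η·m(φ) + εL⁴`, where (abbreviations pinned by equations)
`n = ⌊(1−δ)L²/2⌋`, `W = liebW n φ`, `A = CFC.abs W`, `T a = 𝒯_a = Σ_x B_{x,x+a}`,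
`32·Leak = 8·Σ_a Re[Tr(Aᴴ𝒯_aA𝒯_aᵀ) − Tr(Wᴴ𝒯_aW𝒯_aᵀ)]` — the zero-momentum-transfer discordance
`8L²Σ_k[⟨n_{k↑}n_{−k↓}⟩_φ̃ − ⟨n_{k↑}n_{−k↓}⟩_φ]` (`≥ 0` on real flip-definite vectors: landed `stub_leakNonneg`, p164144) —
and `m = F_s(φ̃) − F_s(φ)`. Why plausibly true: `Leak = 0` exactly for every configuration-diagonal ("gap-sign") involution
(number-projected BCS of any symmetry: ⟨n_{k↑}n_{−k↓}⟩ = ⟨n_k⟩ is already maximal), `O(U³)` at fixed `L`; fails iff the twin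
of some ground-state family counts macroscopically more doubly-occupied Cooper partners `(k↑, −k↓)` than the state (normal `φ`
with condensed twin; the η_π-tower, where `32·Leak = 4m` exactly). Size: XL — summit-type content at a K2 point (card).
Must use minimality. -/
theorem stub_leakBound :
    ∀ U ∈ Set.Ioc (0 : ℝ) 4, ∀ δ ∈ Set.Icc (1 / 10 : ℝ) (3 / 10), ∃ η : ℝ, η < 2 ∧ ∀ ε : ℝ, 0 < ε →
      ∃ L₀ : ℕ, ∀ (L : ℕ) [NeZero L], L₀ ≤ L → Even L → ∀ n : ℕ, n = ⌊(1 - δ) * (L : ℝ) ^ 2 / 2⌋₊ →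
        ∀ φ : Fock (Orb (FermionTorus 2 L)), star φ ⬝ᵥ φ = 1 →
          IsGroundStateInSector (hubbardTorus 2 L 1 U) (2 * n) 0 φ →
            ∀ (W A : Matrix (Config (FermionTorus 2 L) n) (Config (FermionTorus 2 L) n) ℂ)
              (T : TorusSite 2 L → Matrix (Config (FermionTorus 2 L) n) (Config (FermionTorus 2 L) n) ℂ),
              W = liebW n φ → A = CFC.abs W →
                (T = fun a => ∑ x : TorusSite 2 L,
                  configHop n (FermionTorus.ofTorusSite x) (FermionTorus.ofTorusSite (x + a))) →
                  8 * (∑ a : TorusSite 2 L,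
                      ((Aᴴ * T a * A * (T a)ᵀ).trace - (Wᴴ * T a * W * (T a)ᵀ).trace)).re ≤
                    η * ((expect ((pairField sWave L)ᴴ * pairField sWave L) (liebVec n A)).re -
                          (expect ((pairField sWave L)ᴴ * pairField sWave L) φ).re) +
                      ε * (L : ℝ) ^ 4 := by
  sorry

/-- STUB 3 — EXOTIC BUDGET (physics bet 2 of card channel-exhaustion-sum-rule; engine-less ground-state conjecture):
for every `(U, δ)` in the box there is `θ < 2` such that for every `ε > 0`, eventually in even `L`, every normalised
sector ground state `φ` has `8·Exotic(φ) ≤ θ·m(φ) + εL⁴`, where (abbreviations pinned by equations) `φt = liebVec n A` is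
the twin, `B x x' = configHop n x x'`, `trG = Re Tr G = Σ_r Σ_{x,x'} Re[Tr(Wᴴ B_{xx'} W B_{x+r,x'+r}ᵀ) − (same with A)]`
(total relative-channel gain of the state over its twin), `m, dgain, xgain` the on-site mass and the `d` / extended-`s`
gains, and `8·Exotic = 8·trG + 4m − dgain − xgain` is the gain carried by the NN spin-triplet, `d_xy` and all
range-`≥ √2` channels. Why plausibly true: on the BCS anchor `Exotic < 0` (the twin's extended `A₁g` tail enters with the
helpful sign; 4×4 anchor `D/m ≈ 7 > 4`); holds with `θ = 0` on the η_π-tower (`G(r,r) = 0` for `r ≠ 0`, wave-1 worker);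
fails iff the sign defect of some ground-state family is sunk in `d_xy` / longer-range / nodal pairs. Size: XL.
Wave-1 verdict: `stub-blocked: none-in-tree` (no misstatement). -/
theorem stub_exoticBudget :
    ∀ U ∈ Set.Ioc (0 : ℝ) 4, ∀ δ ∈ Set.Icc (1 / 10 : ℝ) (3 / 10), ∃ θ : ℝ, θ < 2 ∧ ∀ ε : ℝ, 0 < ε →
      ∃ L₀ : ℕ, ∀ (L : ℕ) [NeZero L], L₀ ≤ L → Even L → ∀ n : ℕ, n = ⌊(1 - δ) * (L : ℝ) ^ 2 / 2⌋₊ →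
        ∀ φ : Fock (Orb (FermionTorus 2 L)), star φ ⬝ᵥ φ = 1 →
          IsGroundStateInSector (hubbardTorus 2 L 1 U) (2 * n) 0 φ →
            ∀ (W A : Matrix (Config (FermionTorus 2 L) n) (Config (FermionTorus 2 L) n) ℂ)
              (φt : Fock (Orb (FermionTorus 2 L)))
              (B : TorusSite 2 L → TorusSite 2 L →
                Matrix (Config (FermionTorus 2 L) n) (Config (FermionTorus 2 L) n) ℂ),
              W = liebW n φ → A = CFC.abs W → φt = liebVec n A →
                (B = fun x x' => configHop n (FermionTorus.ofTorusSite x) (FermionTorus.ofTorusSite x')) →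
                  ∀ trG m dgain xgain : ℝ,
                    trG = (∑ r : TorusSite 2 L, ∑ x : TorusSite 2 L, ∑ x' : TorusSite 2 L,
                      ((Wᴴ * B x x' * W * (B (x + r) (x' + r))ᵀ).trace -
                        (Aᴴ * B x x' * A * (B (x + r) (x' + r))ᵀ).trace)).re →
                    m = (expect ((pairField sWave L)ᴴ * pairField sWave L) φt).re -
                      (expect ((pairField sWave L)ᴴ * pairField sWave L) φ).re →
                    dgain = (expect ((pairField dWaveFormFactor L)ᴴ * pairField dWaveFormFactor L) φ).re -
                      (expect ((pairField dWaveFormFactor L)ᴴ * pairField dWaveFormFactor L) φt).re →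
                    xgain = (expect ((pairField extendedSWave L)ᴴ * pairField extendedSWave L) φ).re -
                      (expect ((pairField extendedSWave L)ᴴ * pairField extendedSWave L) φt).re →
                      8 * trG + 4 * m - dgain - xgain ≤ θ * m + ε * (L : ℝ) ^ 4 := by
  sorry

/-- STUB 4 — NO ON-SITE CONDENSATE = the sibling crux `Theses.LiebTwin.NoOnsiteODLRO` VERBATIM (shared item
stmt-HubbardSuperconductivity-0933, route EnslavedA1g; hypothesis `hNo` of `LiebTwin.closes`, so it costs nothing at
route level). Through the landed slaving theorem `LiebTwinBondLocality.extendedS_le_of_noOnsiteODLRO` it closes the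
extended-`s` sink: `X ≤ εL⁴` uniformly on the box. OPEN (wave-1 verdict: `stub-blocked: stmt-HubbardSuperconductivity-0933`). -/
theorem stub_noOnsiteODLRO :
    Summit.HubbardSuperconductivity.HubbardSuperconductivity.Theses.LiebTwin.NoOnsiteODLRO := by
  sorry

/-! ## Assembly -/

/-- ASSEMBLY (kernel-checked, no `sorry`): the two budgets + the sibling crux (hypotheses, by registered stub name)
and the landed channel completeness imply the crux `DWavePolarisedDiscordance` BY NAME, with `κ = 4 − η − θ` and
`ε/3` bookkeeping. -/
theorem DWavePolarisedDiscordance_of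
    (hLeak : __Registered.stub_leakBound) (hExo : __Registered.stub_exoticBudget)
    (hNo : __Registered.stub_noOnsiteODLRO) :
    Summit.HubbardSuperconductivity.HubbardSuperconductivity.Theses.LiebTwin.DWavePolarisedDiscordance := by
  -- stub 1 (channel completeness) is CLOSED: landed `LiebTwinChannelExhaustion.stub_channelCompleteness` (p163800)
  have hCC : __Registered.stub_channelCompleteness :=
    Summit.HubbardSuperconductivity.HubbardSuperconductivity.Theorems.LiebTwinChannelExhaustion.stub_channelCompleteness
  intro U hU δ hδ
  obtain ⟨η, hη, hLeak⟩ := hLeak U hU δ hδ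
  obtain ⟨θ, hθ, hExo⟩ := hExo U hU δ hδ
  refine ⟨4 - η - θ, by linarith, fun ε hε => ?_⟩
  obtain ⟨L₁, h1⟩ := hLeak (ε / 3) (by positivity)
  obtain ⟨L₂, h2⟩ := hExo (ε / 3) (by positivity)
  obtain ⟨L₃, h3⟩ :=
    Summit.HubbardSuperconductivity.HubbardSuperconductivity.Theorems.LiebTwinBondLocality.extendedS_le_of_noOnsiteODLRO
      hNo U hU δ hδ (ε / 3) (by positivity)
  refine ⟨L₁ + L₂ + L₃, fun L _ hL hE φ hφ hgs => ?_⟩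
  have h1' := h1 L (by omega) hE _ rfl φ hφ hgs _ _ _ rfl rfl rfl
  have h2' := h2 L (by omega) hE _ rfl φ hφ hgs _ _ _ _ rfl rfl rfl rfl _ _ _ _ rfl rfl rfl rfl
  have h3' := h3 L (by omega) hE φ hφ hgs
  -- the twin's extended-s order is nonnegative
  have hX' := Summit.HubbardSuperconductivity.HubbardSuperconductivity.Theorems.re_expect_pairField_conjTranspose_mul_nonneg
    extendedSWave L (liebVec ⌊(1 - δ) * (L : ℝ) ^ 2 / 2⌋₊ (CFC.abs (liebW ⌊(1 - δ) * (L : ℝ) ^ 2 / 2⌋₊ φ)))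
  -- channel completeness, for the state and for the twin
  have hW := hCC L ⌊(1 - δ) * (L : ℝ) ^ 2 / 2⌋₊ (liebW ⌊(1 - δ) * (L : ℝ) ^ 2 / 2⌋₊ φ)ᴴ
    (liebW ⌊(1 - δ) * (L : ℝ) ^ 2 / 2⌋₊ φ)
  have hA := hCC L ⌊(1 - δ) * (L : ℝ) ^ 2 / 2⌋₊ (CFC.abs (liebW ⌊(1 - δ) * (L : ℝ) ^ 2 / 2⌋₊ φ))ᴴ
    (CFC.abs (liebW ⌊(1 - δ) * (L : ℝ) ^ 2 / 2⌋₊ φ))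
  simp only [Finset.sum_sub_distrib, Complex.sub_re] at h1' h2'
  rw [hW, hA] at h2'
  linarith

/-- Wiring check (an `example`, so that `DWavePolarisedDiscordance_of` stays the only theorem concluding the
crux): the registered stubs feed the skeleton theorem as stated — this term becomes the crux proof when the
three remaining `sorry`s above are discharged. -/
example : Summit.HubbardSuperconductivity.HubbardSuperconductivity.Theses.LiebTwin.DWavePolarisedDiscordance :=
  DWavePolarisedDiscordance_of stub_leakBound stub_exoticBudget stub_noOnsiteODLRO

end Summit.HubbardSuperconductivity.HubbardSuperconductivity.Cruxes.DWavePolarisedDiscordance.Sketch
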